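import Literature.NumberTheory.FaltingsSerre.Paramodular353
import Literature.NumberTheory.FaltingsSerre.CriterionProofs
import HarnessLib

/-!
# `A₃₅₃` is paramodular of level `353` away from `353`, from the frozen certificate — criterion discharged

[BPPTVY] = A. Brumer, A. Pacetti, C. Poor, G. Tornaría, J. Voight, D. S. Yuen, *On the paramodularity of
typical abelian surfaces*, Algebra & Number Theory **13**:5 (2019) 1145–1195 [cite: BrumerEtAl2019];
the conclusion is their PUBLISHED Theorem 7.2.1 (p. 1189: the Jacobian of `C₃₅₃ : y² + (x³+x+1)y = x²`,
LMFDB `353.a.353.1`, is paramodular of level `353`; residual image `S₃ ≀ C₂`), re-certified by the cell.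

`Literature.NumberTheory.FaltingsSerre.Paramodular353.paramodular_353` (p188920, instance of
`ParamodularTemplate.lean` for the frozen certificate `certs/353/certificate.canonical.json`, sha256
`f9c58454c0fee8091a6b9e1fefbb18ffc9cb091db6d4d5113f028da54859e767`) carries the hypothesis
`hFS : traceEq_of_faltingsSerre_symplectic` (the Faltings–Serre criterion [BPPTVY, Thm. 2.1.5 p. 1150 /
Alg. 2.4.1 p. 1155] as a named statement).  That statement is PROVED in the tree
(`Literature.NumberTheory.FaltingsSerre.traceEq_of_faltingsSerre_symplectic_holds`, `CriterionProofs.lean`,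
p181742), so — exactly as `ParamodularUnconditional.paramodular_277_holds` (N = 277) and
`Paramodular349.paramodular_349_holds` (N = 349) do — this file restates `paramodular_353` WITHOUT `hFS`.
Remaining binders: the certificate `hC` (discharged outside the kernel, every load-bearing datum by two
independent implementations; referee ruling S44, REFEREE.md R47 Audit 75), the `A`-side frame/Euler data,
the cited `ρ_{f,2}` of [BPPTVY, Thm. 4.3.4 p. 1169] (`hρf`, Arthur-dependent via Mok), the form data
([PY15] Thm 7.4 pp. 1433–1434 made unconditional by [PSY20] Thm 1.1, as [BPPTVY, (6.2.6) p. 1179] says),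
and the hand check at `p = 2` (`a₂ = −1`, `b₂ = 3` on both sides).  No new mathematics: a kernel
re-certification of a published theorem, never a 'new' instance.
-/

noncomputable section

namespace Literature.NumberTheory.FaltingsSerre.Paramodular353

open Polynomial IsDedekindDomain
open Literature.NumberTheory.FaltingsSerre Literature.NumberTheory.GaloisRepresentations
  Literature.NumberTheory.Automorphic.Paramodular Literature.NumberTheory.Automorphic
  Literature.AlgebraicGeometry.Motives
open scoped NumberField

/-- **`A₃₅₃` is paramodular of level `353` away from `353` — criterion discharged**: the statement of
`paramodular_353` without `hFS`, supplied by `traceEq_of_faltingsSerre_symplectic_holds`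
([BPPTVY, Thm. 2.1.5 p. 1150 / Alg. 2.4.1 p. 1155], proved in `CriterionProofs.lean`). [cite: BrumerEtAl2019, Thm 7.2.1 p. 1189; Thm 2.1.5 p. 1150; Alg 2.4.1 p. 1155; Thm 4.3.4 p. 1169] -/
theorem paramodular_353_holds
    {A : AbelianVariety ℚ} {f : Matrix (Fin 2) (Fin 2) ℂ → ℂ}
    {ρA ρf : FramedGaloisRep ℚ ℤ_[2] 4} {J : Matrix (Fin 4) (Fin 4) ℤ_[2]}
    {ν : Field.absoluteGaloisGroup ℚ → ℤ_[2]}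
    {b : Module.Basis (Fin 4) ℚ_[2] (A.rationalTateModule 2)}
    (hC : Certificate353 J ν ρA ρf)
    (hframe : A.IsFrameOfTateRep 2 b (rationalize ρA))
    (aA bA af bf : ℕ → ℤ)
    (hA : ∀ p : ℕ, p.Prime → ¬ p ∣ 353 →
      A.HasGoodEulerFactorAt p ((lPolynomialOfSurface p (aA p) (bA p)).map (Int.castRingHom ℚ)))
    (hρf : ∀ p : ℕ, p.Prime → ¬ p ∣ 353 → p ≠ 2 →
      ∀ v : HeightOneSpectrum (𝓞 ℚ), ((p : ℕ) : 𝓞 ℚ) ∈ v.asIdeal →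
        ρf.HasFrobCharpolyAt v
          ((lPolynomialOfSurface p (af p) (bf p)).reverse.map (Int.castRingHom ℤ_[2])))
    (hcusp : IsParamodularCuspForm 353 2 f) (hne : ∃ Z ∈ siegelUpperHalfSpace 2, f Z ≠ 0)
    (hfe : ∀ p : ℕ, p.Prime → ¬ p ∣ 353 →
      HasSpinorEulerFactorAt 2 p f ((lPolynomialOfSurface p (af p) (bf p)).map (Int.castRingHom ℂ)))
    (h2 : aA 2 = af 2 ∧ bA 2 = bf 2) :
    IsParamodularAwayFrom A 353 f :=
  paramodular_353 traceEq_of_faltingsSerre_symplectic_holds hC hframe aA bA af bf hA hρf hcusp hne hfe h2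

/-- The unconditional conclusion at one prime `p ≠ 353`: one polynomial is both `L_p(A₃₅₃,T)` and
`Q_p(f₃₅₃,T)`. [cite: BrumerEtAl2019, Thm 7.2.1 p. 1189] -/
theorem eulerFactors_agree_353_holds
    {A : AbelianVariety ℚ} {f : Matrix (Fin 2) (Fin 2) ℂ → ℂ}
    {ρA ρf : FramedGaloisRep ℚ ℤ_[2] 4} {J : Matrix (Fin 4) (Fin 4) ℤ_[2]}
    {ν : Field.absoluteGaloisGroup ℚ → ℤ_[2]}
    {b : Module.Basis (Fin 4) ℚ_[2] (A.rationalTateModule 2)}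
    (hC : Certificate353 J ν ρA ρf)
    (hframe : A.IsFrameOfTateRep 2 b (rationalize ρA))
    (aA bA af bf : ℕ → ℤ)
    (hA : ∀ p : ℕ, p.Prime → ¬ p ∣ 353 →
      A.HasGoodEulerFactorAt p ((lPolynomialOfSurface p (aA p) (bA p)).map (Int.castRingHom ℚ)))
    (hρf : ∀ p : ℕ, p.Prime → ¬ p ∣ 353 → p ≠ 2 →
      ∀ v : HeightOneSpectrum (𝓞 ℚ), ((p : ℕ) : 𝓞 ℚ) ∈ v.asIdeal →
        ρf.HasFrobCharpolyAt v
          ((lPolynomialOfSurface p (af p) (bf p)).reverse.map (Int.castRingHom ℤ_[2])))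
    (hcusp : IsParamodularCuspForm 353 2 f) (hne : ∃ Z ∈ siegelUpperHalfSpace 2, f Z ≠ 0)
    (hfe : ∀ p : ℕ, p.Prime → ¬ p ∣ 353 →
      HasSpinorEulerFactorAt 2 p f ((lPolynomialOfSurface p (af p) (bf p)).map (Int.castRingHom ℂ)))
    (h2 : aA 2 = af 2 ∧ bA 2 = bf 2) {p : ℕ} (hp : p.Prime) (hpN : p ≠ 353) :
    ∃ Q : Polynomial ℚ, HasSpinorEulerFactorAt 2 p f (Q.map (algebraMap ℚ ℂ)) ∧
      A.HasGoodEulerFactorAt p Q :=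
  eulerFactors_agree_353 (paramodular_353_holds hC hframe aA bA af bf hA hρf hcusp hne hfe h2) hp hpN

end Literature.NumberTheory.FaltingsSerre.Paramodular353

end
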